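import Literature.NumberTheory.EllipticCurves.PoonenRainsCocycle
import Literature.Algebra.Homology.HeisenbergLevelStructure
import HarnessLib

/-!
# Heisenberg data from a twisted bilinear cocycle: `m(x, y) = η_x η_y η_{x+y}⁻¹ · P(x, y)`
# (the algebraic theta groups of Morgan–Smith, Def. 5.19, in the tree's cochain language)

Topic `NumberTheory/EllipticCurves`; namespace `Literature.NumberTheory.EllipticCurves`.  Definitions with
bodies and theorems only: **no named fact is introduced** (D-0026).

For an elliptic curve `E/K` (model `W`), a level `N`, a multiplicatively bi-additive `Γ_K`-equivariant
nowhere-vanishing pairing `P : E[N] × E[N] → K̄` and a `Γ_K`-INVARIANT function `η : E[N] → K̄ˣ` with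
`η 0 = 1`, the group `U = K̄ˣ × E[N]` with multiplication `(α, x)(α′, y) = (α α′ P(x, y), x + y)`
(Poonen–Rains 2011 / Morgan–Smith 2021 Def. 5.19) and diagonal Galois action, read through the section
`x ↦ (η_x, x)`, is the Heisenberg datum (`Literature.Algebra.Homology.HeisenbergDatum`)

  `m(x, y) = η_x + η_y − η_{x+y} + P(x, y)`,  `χ_σ(x) = σ η_x − η_x`   (additive notation in `Additive K̄ˣ`)

(`twistGm`; axioms: the `2`-cocycle identity of `m` is the bi-additivity of `P`, `smul_m` is the
equivariance of `P` and the invariance of `η`, `χ_mul` is the invariance of `η`).  Its commutator form is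
`P(x, y) P(y, x)⁻¹` (`toMul_commForm_twistGm`).  When all `m(x, y)` and `χ_σ(x)` are `n`-th roots of unity
(hypotheses `hmn`, `hχn`) the values are restricted to `μₙ ≤ K̄ˣ` and transported to the carrier
`MuCarrier K n` of the tree's Galois module `μₙ` (`twistMu`, via `HeisenbergDatum.codRestrict` /
`mapValues`; `muSub`, `muSubToCarrier`, `muActionAt` generalise the level-`2` plumbing of
`ThetaDatumWeierstrass`).  The sequel instantiates `N = 2m²`, `P` a square root of `e_{m²} ∘ ([2] × [2])`
and `η` the normalisation by the Arf-invariant-`1` quadratic form on `E[2]`, giving a theta group of level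
`m²` with a level structure (Cassels–Tate alternation at even level).

References: [MorganSmith2021CTP] A. Morgan, A. Smith, arXiv:2103.08530, §5.3 Def. 5.19 (the group `U`,
`N`, `𝓗(M[λ])`); [PoonenRains2012] §4.1; [SerreGaloisCohomology1997] I §5.7, II §1.2.
-/

noncomputable section

open scoped Classical

universe u

namespace Literature.NumberTheory.EllipticCurves

open _root_.WeierstrassCurve Field Function
open Literature.NumberTheory.GaloisRepresentations
open Literature.NumberTheory.GaloisRepresentations.DiscreteGaloisModule (mu MuCarrier)
open Literature.Algebra.Homology

variable {K : Type u} [Field K]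

/-! ### `μₙ ≤ K̄ˣ` and the carrier of the Galois module `μₙ`, at any level -/

section Mu

variable (K) (n : ℕ)

/-- `μₙ(K̄) ≤ K̄ˣ` as an additive subgroup of `Additive K̄ˣ`. [cite: SerreGaloisCohomology1997, II §1.2 (μₙ ⊂ K̄ˣ)] -/
def muSub : AddSubgroup (Additive (AlgebraicClosure K)ˣ) := (rootsOfUnity n (AlgebraicClosure K)).toAddSubgroup

variable {K n}

/-- Membership in `muSub`: `u ∈ μₙ ↔ uⁿ = 1`. [cite: SerreGaloisCohomology1997, II §1.2 (μₙ ⊂ K̄ˣ)] -/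
theorem mem_muSub_iff (u : Additive (AlgebraicClosure K)ˣ) :
    u ∈ muSub K n ↔ (Additive.toMul u : (AlgebraicClosure K)ˣ) ^ n = 1 := by
  rw [muSub, Additive.mem_toAddSubgroup, mem_rootsOfUnity]

/-- The Galois action on `K̄ˣ` (`ThetaLevelTwo.ThetaData.unitsAction`) preserves `μₙ`. [cite: SerreGaloisCohomology1997, II §1.2 (μₙ is a Galois submodule)] -/
theorem unitsAction_mem_muSub (σ : absoluteGaloisGroup K) (u : Additive (AlgebraicClosure K)ˣ)
    (hu : u ∈ muSub K n) : ThetaLevelTwo.ThetaData.unitsAction (absoluteGaloisGroup K) (AlgebraicClosure K) σ u ∈ muSub K n := by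
  rw [mem_muSub_iff] at hu ⊢
  apply Units.ext
  rw [Units.val_pow_eq_pow_val, ThetaLevelTwo.ThetaData.coe_toMul_unitsAction, ← smul_pow', ← Units.val_pow_eq_pow_val, hu,
    Units.val_one]
  exact smul_one σ

variable (K n)

/-- The identification `μₙ ≤ K̄ˣ` (additive subgroup) `→ MuCarrier K n`. [cite: SerreGaloisCohomology1997, II §1.2 (μₙ ⊂ K̄ˣ)] -/
def muSubToCarrier : muSub K n →+ MuCarrier K n where
  toFun a := MuCarrier.ofRootsOfUnity ⟨Additive.toMul (a : Additive (AlgebraicClosure K)ˣ),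
    (Additive.mem_toAddSubgroup _ _).mp a.2⟩
  map_zero' := rfl
  map_add' _ _ := rfl

/-- `muSubToCarrier` on values in `K̄`. [cite: SerreGaloisCohomology1997, II §1.2 (μₙ ⊂ K̄ˣ)] -/
@[simp] theorem coe_muSubToCarrier (a : muSub K n) :
    (((Additive.toMul (MuCarrier.toAdditive (muSubToCarrier K n a))
        : rootsOfUnity n (AlgebraicClosure K)) : (AlgebraicClosure K)ˣ) : AlgebraicClosure K)
      = ((Additive.toMul (a : Additive (AlgebraicClosure K)ˣ) : (AlgebraicClosure K)ˣ) : AlgebraicClosure K) :=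
  rfl

/-- The Galois action on the carrier `MuCarrier K n` (the representation of `DiscreteGaloisModule.mu K n`),
as additive endomorphisms. [cite: SerreGaloisCohomology1997, II §1.2 (μₙ as a Galois module)] -/
def muActionAt : absoluteGaloisGroup K →* AddMonoid.End (MuCarrier K n) where
  toFun σ := ((mu K n).toRepresentation σ).toAddMonoidHom
  map_one' := by
    apply AddMonoidHom.ext
    intro z
    show (mu K n).toRepresentation 1 z = z
    rw [map_one]
    rfl
  map_mul' σ τ := by
    apply AddMonoidHom.ext
    intro z
    show (mu K n).toRepresentation (σ * τ) z = (mu K n).toRepresentation σ ((mu K n).toRepresentation τ z)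
    rw [map_mul]
    rfl

/-- `muActionAt σ z = mu K n σ z`. [cite: SerreGaloisCohomology1997, II §1.2 (μₙ as a Galois module)] -/
@[simp] theorem muActionAt_apply (σ : absoluteGaloisGroup K) (z : MuCarrier K n) : muActionAt K n σ z = mu K n σ z := rfl

end Mu

/-! ### The twisted bilinear Heisenberg datum with values in `K̄ˣ` -/

section Twist

variable (W : WeierstrassCurve K) (N : ℕ)

/-- The Galois action on `E[N]` as additive endomorphisms (`σ ↦ (P ↦ σP)`). [cite: SilvermanAEC2009, III.§7 (the representation on E[m])] -/
def torsionActionAt : absoluteGaloisGroup K →* AddMonoid.End (geomTorsion W (N : ℤ)) :=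
  DistribMulAction.toAddMonoidEnd (absoluteGaloisGroup K) (geomTorsion W (N : ℤ))

/-- `torsionActionAt σ x = σ • x`. [cite: SilvermanAEC2009, III.§7 (the representation on E[m])] -/
@[simp] theorem torsionActionAt_apply (σ : absoluteGaloisGroup K) (x : geomTorsion W (N : ℤ)) :
    torsionActionAt W N σ x = σ • x := rfl

variable (P : geomTorsion W (N : ℤ) → geomTorsion W (N : ℤ) → AlgebraicClosure K)
  (hP0 : ∀ x y, P x y ≠ 0)
  (hPadd₁ : ∀ x₁ x₂ y, P (x₁ + x₂) y = P x₁ y * P x₂ y)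
  (hPadd₂ : ∀ x y₁ y₂, P x (y₁ + y₂) = P x y₁ * P x y₂)
  (hPgal : ∀ (σ : absoluteGaloisGroup K) (x y : geomTorsion W (N : ℤ)), σ • P x y = P (σ • x) (σ • y))
  (η : geomTorsion W (N : ℤ) → (AlgebraicClosure K)ˣ)
  (hη0 : η 0 = 1)
  (hηgal : ∀ (σ : absoluteGaloisGroup K) (x : geomTorsion W (N : ℤ)), η (σ • x) = η x)

/-- The values of `P` as units. [cite: MorganSmith2021CTP, §5.3 Def. 5.19 (the group U)] -/
def pairUnit (x y : geomTorsion W (N : ℤ)) : (AlgebraicClosure K)ˣ := Units.mk0 (P x y) (hP0 x y)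

/-- Value of `pairUnit`. [cite: MorganSmith2021CTP, §5.3 Def. 5.19 (the group U)] -/
@[simp] theorem coe_pairUnit (x y : geomTorsion W (N : ℤ)) : (pairUnit W N P hP0 x y : AlgebraicClosure K) = P x y := rfl

include hP0 hPadd₁ in
/-- `P(0, y) = 1`. [cite: MorganSmith2021CTP, §5.3 Def. 5.19 (the group U)] -/
theorem pair_zero_left (y : geomTorsion W (N : ℤ)) : P 0 y = 1 := by
  have h := hPadd₁ 0 0 y
  rw [add_zero] at h
  exact (mul_eq_left₀ (hP0 0 y)).mp h.symm

include hP0 hPadd₂ in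
/-- `P(x, 0) = 1`. [cite: MorganSmith2021CTP, §5.3 Def. 5.19 (the group U)] -/
theorem pair_zero_right (x : geomTorsion W (N : ℤ)) : P x 0 = 1 := by
  have h := hPadd₂ x 0 0
  rw [add_zero] at h
  exact (mul_eq_left₀ (hP0 x 0)).mp h.symm

include hPadd₁ hPadd₂ hPgal hη0 hηgal in
/-- **The twisted bilinear Heisenberg datum with values in `K̄ˣ`** (additively: `Additive K̄ˣ`):
`m(x, y) = η_x + η_y − η_{x+y} + P(x, y)`, `χ_σ(x) = σ η_x − η_x` — Morgan–Smith's group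
`U = K̄ˣ × E[N]`, `(α, x)(α′, y) = (αα′P(x,y), x + y)`, with its diagonal Galois action, read through the
section `x ↦ (η_x, x)`. [cite: MorganSmith2021CTP, §5.3 Def. 5.19 (the group U)] -/
def twistGm : HeisenbergDatum (absoluteGaloisGroup K) (geomTorsion W (N : ℤ)) (Additive (AlgebraicClosure K)ˣ) where
  ρ := torsionActionAt W N
  α := ThetaLevelTwo.ThetaData.unitsAction (absoluteGaloisGroup K) (AlgebraicClosure K)
  m x y := Additive.ofMul (η x) + Additive.ofMul (η y) - Additive.ofMul (η (x + y)) +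
    Additive.ofMul (pairUnit W N P hP0 x y)
  χ σ x := ThetaLevelTwo.ThetaData.unitsAction (absoluteGaloisGroup K) (AlgebraicClosure K) σ (Additive.ofMul (η x)) -
    Additive.ofMul (η x)
  m_zero_left y := by
    have h0 : pairUnit W N P hP0 0 y = 1 := Units.ext (by rw [coe_pairUnit, pair_zero_left W N P hP0 hPadd₁, Units.val_one])
    rw [zero_add, hη0, h0]
    simp
  m_zero_right x := by
    have h0 : pairUnit W N P hP0 x 0 = 1 := Units.ext (by rw [coe_pairUnit, pair_zero_right W N P hP0 hPadd₂, Units.val_one])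
    rw [add_zero, hη0, h0]
    simp
  m_cocycle x y z := by
    have hP : Additive.ofMul (pairUnit W N P hP0 x y) + Additive.ofMul (pairUnit W N P hP0 (x + y) z) =
        Additive.ofMul (pairUnit W N P hP0 y z) + Additive.ofMul (pairUnit W N P hP0 x (y + z)) := by
      rw [← ofMul_mul, ← ofMul_mul]
      refine congrArg Additive.ofMul (Units.ext ?_)
      simp only [Units.val_mul, coe_pairUnit, hPadd₁, hPadd₂]
      ring
    rw [add_assoc x y z]
    linear_combination (norm := abel) hP
  smul_m σ x y := by
    have hgalu : ThetaLevelTwo.ThetaData.unitsAction (absoluteGaloisGroup K) (AlgebraicClosure K) σ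
        (Additive.ofMul (pairUnit W N P hP0 x y)) = Additive.ofMul (pairUnit W N P hP0 (σ • x) (σ • y)) := by
      apply Additive.toMul.injective
      apply Units.ext
      rw [ThetaLevelTwo.ThetaData.coe_toMul_unitsAction, toMul_ofMul, toMul_ofMul, coe_pairUnit, coe_pairUnit, hPgal]
    simp only [torsionActionAt_apply, map_add, map_sub, hgalu, ← smul_add, hηgal]
    abel
  χ_mul σ τ x := by
    simp only [torsionActionAt_apply, map_mul, AddMonoid.End.coe_mul, Function.comp_apply, map_sub, hηgal]
    abel

/-- The module action of `twistGm` is the Galois action on `E[N]`. [cite: SilvermanAEC2009, III.§7 (the representation on E[m])] -/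
@[simp] theorem twistGm_ρ_apply (σ : absoluteGaloisGroup K) (x : geomTorsion W (N : ℤ)) :
    (twistGm W N P hP0 hPadd₁ hPadd₂ hPgal η hη0 hηgal).ρ σ x = σ • x := rfl

/-- The value action of `twistGm` is the Galois action on `K̄ˣ`. [cite: PoonenRains2012, §4.1 (Galois action on the Heisenberg group)] -/
@[simp] theorem twistGm_α :
    (twistGm W N P hP0 hPadd₁ hPadd₂ hPgal η hη0 hηgal).α =
      ThetaLevelTwo.ThetaData.unitsAction (absoluteGaloisGroup K) (AlgebraicClosure K) := rfl

/-- The cocycle of `twistGm`. [cite: MorganSmith2021CTP, §5.3 Def. 5.19 (the group U)] -/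
theorem twistGm_m (x y : geomTorsion W (N : ℤ)) :
    (twistGm W N P hP0 hPadd₁ hPadd₂ hPgal η hη0 hηgal).m x y =
      Additive.ofMul (η x) + Additive.ofMul (η y) - Additive.ofMul (η (x + y)) +
        Additive.ofMul (pairUnit W N P hP0 x y) := rfl

/-- The correction terms of `twistGm`. [cite: MorganSmith2021CTP, §5.3 Def. 5.19 (the group U)] -/
theorem twistGm_χ (σ : absoluteGaloisGroup K) (x : geomTorsion W (N : ℤ)) :
    (twistGm W N P hP0 hPadd₁ hPadd₂ hPgal η hη0 hηgal).χ σ x =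
      ThetaLevelTwo.ThetaData.unitsAction (absoluteGaloisGroup K) (AlgebraicClosure K) σ (Additive.ofMul (η x)) -
        Additive.ofMul (η x) := rfl

/-- The cocycle of `twistGm` in `K̄`: `m(x,y) = η_x η_y P(x,y) / η_{x+y}`. [cite: MorganSmith2021CTP, §5.3 Def. 5.19 (the group U)] -/
theorem coe_toMul_twistGm_m (x y : geomTorsion W (N : ℤ)) :
    ((Additive.toMul ((twistGm W N P hP0 hPadd₁ hPadd₂ hPgal η hη0 hηgal).m x y) : (AlgebraicClosure K)ˣ)
        : AlgebraicClosure K) = η x * η y / η (x + y) * P x y := by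
  rw [twistGm_m, toMul_add, toMul_sub, toMul_add, toMul_ofMul, toMul_ofMul, toMul_ofMul, toMul_ofMul,
    Units.val_mul, Units.val_div_eq_div_val, Units.val_mul, coe_pairUnit]

/-- The correction terms of `twistGm` in `K̄`: `χ_σ(x) = σ(η_x)/η_x`. [cite: MorganSmith2021CTP, §5.3 Def. 5.19 (the group U)] -/
theorem coe_toMul_twistGm_χ (σ : absoluteGaloisGroup K) (x : geomTorsion W (N : ℤ)) :
    ((Additive.toMul ((twistGm W N P hP0 hPadd₁ hPadd₂ hPgal η hη0 hηgal).χ σ x) : (AlgebraicClosure K)ˣ)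
        : AlgebraicClosure K) = σ • (η x : AlgebraicClosure K) / η x := by
  rw [twistGm_χ, toMul_sub, Units.val_div_eq_div_val, ThetaLevelTwo.ThetaData.coe_toMul_unitsAction, toMul_ofMul]

/-- **The commutator form of `twistGm` is `P(x,y)/P(y,x)`** (the `η`-twist is symmetric). [cite: MorganSmith2021CTP, §5.3 Def. 5.19 (the commutator pairing of U)] -/
theorem coe_toMul_commForm_twistGm (x y : geomTorsion W (N : ℤ)) :
    ((Additive.toMul ((twistGm W N P hP0 hPadd₁ hPadd₂ hPgal η hη0 hηgal).commForm x y) : (AlgebraicClosure K)ˣ)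
        : AlgebraicClosure K) = P x y / P y x := by
  rw [HeisenbergDatum.commForm_apply, toMul_sub, Units.val_div_eq_div_val, coe_toMul_twistGm_m,
    coe_toMul_twistGm_m, add_comm y x]
  have h1 : (η x : AlgebraicClosure K) ≠ 0 := (η x).ne_zero
  have h2 : (η y : AlgebraicClosure K) ≠ 0 := (η y).ne_zero
  have h3 : (η (x + y) : AlgebraicClosure K) ≠ 0 := (η (x + y)).ne_zero
  have h4 : P y x ≠ 0 := hP0 y x
  field_simp

/-! ### Values in `μₙ` -/

variable (n : ℕ)
  (hmn : ∀ x y : geomTorsion W (N : ℤ), (η x * η y / η (x + y) * P x y) ^ n = 1)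
  (hχn : ∀ (σ : absoluteGaloisGroup K) (x : geomTorsion W (N : ℤ)), (σ • (η x : AlgebraicClosure K) / η x) ^ n = 1)

include hmn in
/-- The cocycle values lie in `μₙ`. [cite: MorganSmith2021CTP, §5.3 Def. 5.19 (the subgroup of U over μ)] -/
theorem twistGm_m_mem (x y : geomTorsion W (N : ℤ)) :
    (twistGm W N P hP0 hPadd₁ hPadd₂ hPgal η hη0 hηgal).m x y ∈ muSub K n := by
  rw [mem_muSub_iff]
  apply Units.ext
  rw [Units.val_pow_eq_pow_val, coe_toMul_twistGm_m, hmn, Units.val_one]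

include hχn in
/-- The correction terms lie in `μₙ`. [cite: MorganSmith2021CTP, §5.3 Def. 5.19 (the subgroup of U over μ)] -/
theorem twistGm_χ_mem (σ : absoluteGaloisGroup K) (x : geomTorsion W (N : ℤ)) :
    (twistGm W N P hP0 hPadd₁ hPadd₂ hPgal η hη0 hηgal).χ σ x ∈ muSub K n := by
  rw [mem_muSub_iff]
  apply Units.ext
  rw [Units.val_pow_eq_pow_val, coe_toMul_twistGm_χ, hχn, Units.val_one]

/-- `muSubToCarrier` intertwines the restricted action with `muActionAt`. [cite: SerreGaloisCohomology1997, II §1.2 (μₙ as a Galois module)] -/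
theorem muSubToCarrier_α (σ : absoluteGaloisGroup K) (a : muSub K n) :
    muSubToCarrier K n (((twistGm W N P hP0 hPadd₁ hPadd₂ hPgal η hη0 hηgal).codRestrict (muSub K n)
        (fun σ u hu => unitsAction_mem_muSub σ u hu) (twistGm_m_mem W N P hP0 hPadd₁ hPadd₂ hPgal η hη0 hηgal n hmn)
        (twistGm_χ_mem W N P hP0 hPadd₁ hPadd₂ hPgal η hη0 hηgal n hχn)).α σ a)
      = muActionAt K n σ (muSubToCarrier K n a) := by
  apply MuCarrier.toAdditive.injective
  apply Additive.toMul.injective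
  apply Subtype.ext
  apply Units.ext
  rfl

/-- **The twisted bilinear Heisenberg datum with values in the Galois module `μₙ`** (carrier
`MuCarrier K n`): `twistGm` with its values restricted to `μₙ ≤ K̄ˣ` (`hmn`, `hχn`) — the central
extension `0 → μₙ → 𝓗 → E[N] → 0` cut out of Morgan–Smith's `U` by the normalisation `η`.
[cite: MorganSmith2021CTP, §5.3 Def. 5.19 (the theta group 𝓗(M[λ]))] -/
def twistMu : HeisenbergDatum (absoluteGaloisGroup K) (geomTorsion W (N : ℤ)) (MuCarrier K n) :=
  ((twistGm W N P hP0 hPadd₁ hPadd₂ hPgal η hη0 hηgal).codRestrict (muSub K n)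
      (fun σ u hu => unitsAction_mem_muSub σ u hu) (twistGm_m_mem W N P hP0 hPadd₁ hPadd₂ hPgal η hη0 hηgal n hmn)
      (twistGm_χ_mem W N P hP0 hPadd₁ hPadd₂ hPgal η hη0 hηgal n hχn)).mapValues
    (muSubToCarrier K n) (muActionAt K n) (muSubToCarrier_α W N P hP0 hPadd₁ hPadd₂ hPgal η hη0 hηgal n hmn hχn)

/-- The module action of `twistMu` is the Galois action on `E[N]`. [cite: SilvermanAEC2009, III.§7 (the representation on E[m])] -/
@[simp] theorem twistMu_ρ_apply (σ : absoluteGaloisGroup K) (x : geomTorsion W (N : ℤ)) :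
    (twistMu W N P hP0 hPadd₁ hPadd₂ hPgal η hη0 hηgal n hmn hχn).ρ σ x = σ • x := rfl

/-- The value action of `twistMu` is the Galois module `μₙ`. [cite: SerreGaloisCohomology1997, II §1.2 (μₙ as a Galois module)] -/
@[simp] theorem twistMu_α_apply (σ : absoluteGaloisGroup K) (z : MuCarrier K n) :
    (twistMu W N P hP0 hPadd₁ hPadd₂ hPgal η hη0 hηgal n hmn hχn).α σ z = mu K n σ z := rfl

/-- The cocycle of `twistMu`, in `K̄`. [cite: MorganSmith2021CTP, §5.3 Def. 5.19 (the theta group 𝓗(M[λ]))] -/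
theorem coe_twistMu_m (x y : geomTorsion W (N : ℤ)) :
    (((Additive.toMul (MuCarrier.toAdditive ((twistMu W N P hP0 hPadd₁ hPadd₂ hPgal η hη0 hηgal n hmn hχn).m x y))
        : rootsOfUnity n (AlgebraicClosure K)) : (AlgebraicClosure K)ˣ) : AlgebraicClosure K)
      = η x * η y / η (x + y) * P x y := by
  rw [twistMu, HeisenbergDatum.mapValues_m, coe_muSubToCarrier, HeisenbergDatum.coe_codRestrict_m, coe_toMul_twistGm_m]

/-- The correction terms of `twistMu`, in `K̄`. [cite: MorganSmith2021CTP, §5.3 Def. 5.19 (the theta group 𝓗(M[λ]))] -/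
theorem coe_twistMu_χ (σ : absoluteGaloisGroup K) (x : geomTorsion W (N : ℤ)) :
    (((Additive.toMul (MuCarrier.toAdditive ((twistMu W N P hP0 hPadd₁ hPadd₂ hPgal η hη0 hηgal n hmn hχn).χ σ x))
        : rootsOfUnity n (AlgebraicClosure K)) : (AlgebraicClosure K)ˣ) : AlgebraicClosure K)
      = σ • (η x : AlgebraicClosure K) / η x := by
  rw [twistMu, HeisenbergDatum.mapValues_χ, coe_muSubToCarrier, HeisenbergDatum.coe_codRestrict_χ, coe_toMul_twistGm_χ]

/-- **The commutator form of `twistMu` in `K̄` is `P(x,y)/P(y,x)`.** [cite: MorganSmith2021CTP, §5.3 Def. 5.19 (the commutator pairing of U)] -/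
theorem coe_twistMu_commForm (x y : geomTorsion W (N : ℤ)) :
    (((Additive.toMul (MuCarrier.toAdditive
        ((twistMu W N P hP0 hPadd₁ hPadd₂ hPgal η hη0 hηgal n hmn hχn).commForm x y))
        : rootsOfUnity n (AlgebraicClosure K)) : (AlgebraicClosure K)ˣ) : AlgebraicClosure K)
      = P x y / P y x := by
  rw [twistMu, HeisenbergDatum.commForm_mapValues, coe_muSubToCarrier, HeisenbergDatum.coe_commForm_codRestrict,
    coe_toMul_commForm_twistGm]

/-- The obstruction cocycle of `twistMu` in `K̄`: `conn ξ (σ,τ) = (σ η_{ξτ}/η_{ξτ}) · (η_{ξσ} η_{σξτ} P(ξσ, σξτ)/η_{ξσ+σξτ})`.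
[cite: SerreGaloisCohomology1997, I §5.7 (connecting map of a central extension of G-groups)] -/
theorem coe_twistMu_conn (ξ : absoluteGaloisGroup K → geomTorsion W (N : ℤ)) (σ τ : absoluteGaloisGroup K) :
    (((Additive.toMul (MuCarrier.toAdditive
        ((twistMu W N P hP0 hPadd₁ hPadd₂ hPgal η hη0 hηgal n hmn hχn).conn ξ σ τ))
        : rootsOfUnity n (AlgebraicClosure K)) : (AlgebraicClosure K)ˣ) : AlgebraicClosure K)
      = (σ • (η (ξ τ) : AlgebraicClosure K) / η (ξ τ)) *
          (η (ξ σ) * η (σ • ξ τ) / η (ξ σ + σ • ξ τ) * P (ξ σ) (σ • ξ τ)) := by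
  rw [HeisenbergDatum.conn_apply, map_add, toMul_add, Subgroup.coe_mul, Units.val_mul, coe_twistMu_χ, coe_twistMu_m,
    twistMu_ρ_apply]

/-- `χ_σ(x)` depends only on `σ(η_x)`. [cite: PoonenRains2012, §4.1 (Galois action on the Heisenberg group)] -/
theorem twistMu_χ_congr {σ₁ σ₂ : absoluteGaloisGroup K} (x : geomTorsion W (N : ℤ))
    (h : σ₁ • (η x : AlgebraicClosure K) = σ₂ • (η x : AlgebraicClosure K)) :
    (twistMu W N P hP0 hPadd₁ hPadd₂ hPgal η hη0 hηgal n hmn hχn).χ σ₁ x =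
      (twistMu W N P hP0 hPadd₁ hPadd₂ hPgal η hη0 hηgal n hmn hχn).χ σ₂ x := by
  apply MuCarrier.toAdditive.injective
  apply Additive.toMul.injective
  apply Subtype.ext
  apply Units.ext
  rw [coe_twistMu_χ, coe_twistMu_χ, h]

/-- **Continuity of the correction terms**: for fixed `x`, `σ ↦ χ_σ(x) ∈ μₙ` is continuous (locally constant:
it only depends on `σ(η_x)`). [cite: PoonenRains2012, §4.1 (Galois action on the Heisenberg group)] -/
theorem continuous_twistMu_χ (x : geomTorsion W (N : ℤ)) :
    Continuous fun σ : absoluteGaloisGroup K => (twistMu W N P hP0 hPadd₁ hPadd₂ hPgal η hη0 hηgal n hmn hχn).χ σ x := by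
  rw [continuous_discrete_rng]
  intro c
  rw [isOpen_iff_forall_mem_open]
  intro σ₀ hσ₀
  refine ⟨{σ | σ • (η x : AlgebraicClosure K) = σ₀ • (η x : AlgebraicClosure K)}, ?_, ThetaLevelTwo.isOpen_setOf_smul_eq _ _, rfl⟩
  intro σ hσ
  simp only [Set.mem_setOf_eq] at hσ
  simp only [Set.mem_preimage, Set.mem_singleton_iff] at hσ₀ ⊢
  rw [twistMu_χ_congr W N P hP0 hPadd₁ hPadd₂ hPgal η hη0 hηgal n hmn hχn x hσ]
  exact hσ₀

end Twist

end Literature.NumberTheory.EllipticCurves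

end
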